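import Summits.QuantumFields.YangMills.Theorems.LuscherReductionTwistedTraceScalingConstTubeOrtho
import Summits.QuantumFields.YangMills.Theorems.LuscherReductionTwistedTraceScalingInnerKineticSplit
import Summits.QuantumFields.YangMills.Theorems.LuscherReductionTwistedTraceScalingAxisRotation
import Summits.QuantumFields.YangMills.Theorems.TwistedTraceScaling.Negative.OneSiteRouteWindow
import HarnessLib

/-!
# R26 — the ORTHO chart's kinetic exponent has a slow–stiff CORIOLIS cross term: `tc(orthoTube u v, orthoTube u' v')` is NOT `F(u,u'; |v|,|v'|) + G(v,v')`;
# exact two-link witness `Δ(φ) = −4ε²(cos φ ± sin φ)`; exponent lines `s + q' > 4/3` (pointwise on `T×T`) and `q' > 5/6` (kinetic-typical)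
# (crux `LuscherReduction.TwistedTraceScaling`, stmt-QuantumFields-20203; standing disprover, cycle 21; vets lane A g12 `…ConstTubeOrtho`, `…SlowDisintegration`, COARSE-DESIGN §23)

VETTED: `…ConstTubeOrtho` / §23.1 («EXACT Pythagoras splits the kinetic exponent into `L³Σ_k|m_k − m'_k|²` + `Σ_e|fluc_e − fluc'_e|²` with NO slow–stiff cross term») and
§23.2 (3) («`K̃_β(Ψ(u,v),Ψ(u',v')) = 𝒩_g·K₁^{L³β|m||m'|}(u,u')·G_st(w,w')·1(η,η')·(1 ± η_K)` on `T×T`, `G_st` c-FROZEN, `η_K = O(β^{−s}δ_gβ^{1/2})`»).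
FINDING.  Pythagoras is exact in the LAB coordinates `(m_k, fluc_e)`, but `fluc_e = (α_e − ᾱ_k + v⃗_e)·q(u_k)` is the chart coordinate RIGHT-ROTATED by the slow link: in the
chart coordinates `(u, v)` of `orthoTube` — those of (SLOW) and of (3)–(4) — the stiff kinetic term `Σ_e|ṽ_e·q(u_k u'_k⁻¹) − ṽ'_e|²` lives in a frame ROTATING with `u`.
§1: the ortho chart IS G3's product chart (`orthoTube_eq_mul_constLift`), so `timeCoupling_chart_eq` gives the exact split `tc = L³tc₁(u,u') + tc(W_v,W_{v'}) − 2|E|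
+ 2Σ_e(1 − a₀)(1 − b₀) − 2Σ_e b⃗_e·a⃗_{k(e)}`, `b⃗_e = α'_e v_e − α_e v'_e − v'_e × v_e` (`vecPart_relStep_chart`); for BALANCED `v, v'` the linear parts cancel
(`kineticCross_eq_of_balanced`) and the leading cross term is the CORIOLIS term `Σ_e a⃗_{k(e)}·(v'_e × v_e)` — FIRST order in the slow step, second in the stiff amplitude.
§2: two-link witness at every `L ≥ 2` — `v^A` on colour 1, `v^B` on colour 2, amplitudes `±ε` at the links `((0,0,0),0)`, `((1,0,0),0)`, both in `capBalancedSet L`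
(`ε² ≤ 1/4`), IDENTICAL amplitude profiles; slow pair `(w_φ, 1)`, `w_φ = (diagSU2 φ, 1, 1)`: ★★ `cross_witness`: `tc(Ψ(w_φ,v^A),Ψ(1,v^B)) − tc(Ψ(w_φ,v^A),Ψ(1,v^A))
= −4ε²(cos φ + sin φ)`, with the slow step on the other slice `= −4ε²(cos φ − sin φ)`, derivative `−4ε²` at `φ = 0` (first order in the slow angle); hence ★★★
`not_separable_frozen_right` / `_left` / `not_separable`: NO `F, G` with `tc(Ψ(u,v),Ψ(u',v')) = F(u,u'; (|v_e|²)_e, (|v'_e|²)_e) + G(c; v, v')` on `(one-site)² × capBalancedSet²`,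
the stiff factor frozen at `c = u'`, at `c = u`, or slow-independent — the product form of (3) is false as an identity of exponents.
§3 (R23/R25 currency `powScale`, fixed `L`, constants free): on `T×T` the Coriolis exponent reaches `≍ β·β^{−s}·β^{−q'}` (core slow diameter × `S`-cut stiff layer), so a
POINTWISE `η_K = o(λ_b) = o(β^{−1/3})` needs ★ `coriolis_core_line_iff`: `s + q' > 4/3` — never for `s < 1/3`, `q' < 1` (`coriolis_core_line_fails`); it even exceeds lane A's
`η_K = O(β^{−s})` unless `q' > 1` (`coriolis_vs_etaK_iff`); after KINETIC localisation of the slow step to `β^{−1/2}·polylog` (a D0⁺-type tail, to be paid) the line is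
★ `coriolis_typical_line_iff`: `q' > 5/6` — record `q' = 17/20` passes, margin `1/60` (`coriolis_record_lines`).
READING (no kill; for lane A's (3)/(4), owes (iv)).  As an OPERATOR statement the coupling is harmless (first order vanishes in the fibre ground state; second order
renormalises the slow coupling `L³β(1 + O(β^{−1}))`, `o(λ_b)` at fixed `L`; off-diagonal `b ≍ β^{−1/2}`, `b² ≪ λ_b`), but the POINTWISE product form (3) with a slow-independent or
one-sided-frozen `G_st` is false at relative order `β^{1−s−q'}` (`≫ β^{−s}`, `≫ λ_b`): the honest model kernel carries the rotation, `K₁(u,u')·G_st(R_A w, w')`, `R_A` = right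
rotation by `A_k = u_k u'_k⁻¹` per direction (Feshbach (4) then needs `Ω₀`'s response to `R_A`), or (3) is claimed only on the kinetic core `|a⃗| ≤ C√(log β/(L³β))` with the
tail paid by D0⁺ and the stiff layer `q' > 5/6`.  Gauge averaging does not remove it (constant gauge transformations rotate all directions and `u` together; the Coriolis
rotation is direction-resolved; non-constant ones add gauge modes).  HONEST FRAMING: quaternion algebra and exponent bookkeeping on a fixed lattice for a stub of a child of
the CONDITIONAL reduction route R2b1 (femto rung); no kernel estimate refuted or proved; C4 OPEN; not infinite volume, not a gap, not Clay.

## References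
* M. Lüscher, Some analytic results concerning the mass spectrum of Yang–Mills gauge theories on a torus, Nucl. Phys. B219 (1983) 233–261, §3. [Luscher1983]
* T. Bröcker, T. tom Dieck, *Representations of Compact Lie Groups*, Springer GTM 98 (1985), I (1.10). [BrockerTomDieck1985]
-/

set_option autoImplicit false

noncomputable section

open Finset Real
open scoped BigOperators Matrix
open Literature.MathematicalPhysics.QuantumFieldTheory hiding SU2
open Literature.MathematicalPhysics.QuantumLattice

namespace Summit.QuantumFields.YangMills.Theorems.TwistedTraceScaling.Negative.R26

open Summit.QuantumFields.YangMills.Theorems.FemtoTransferGap Summit.QuantumFields.YangMills.Theorems.FemtoTransferGap.TwoLattice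
open Summit.QuantumFields.YangMills.Theorems.FemtoTransferGap.TwoLattice.Toron Summit.QuantumFields.YangMills.Theorems.FemtoTransferGap.TwoLattice.Flat
open Summit.QuantumFields.YangMills.Theorems.FemtoTransferGap.TwoLattice.Cov Summit.QuantumFields.YangMills.Theorems.FemtoTransferGap.TwoLattice.ConstTube

variable {L : ℕ} [NeZero L]

/-! ## §1 The ortho chart is the product chart; the exact split; the relative stiff step in chart coordinates; the Coriolis form -/

/-- ★ **G3's exact kinetic split, verbatim for the ortho chart** (`orthoTube L u v = (chartSU2 ∘ v) · constLift L u`):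
`tc(Ψ(u,v), Ψ(u',v')) = L³·tc₁(u,u') + tc(W_v, W_{v'}) − 2|E| + 2Σ_e(1 − a₀^{k(e)})(1 − b₀^e) − 2Σ_e b⃗_e·a⃗_{k(e)}`, `A_k = u_k u'_k⁻¹`, `B_e = W_{v'}(e)⁻¹ W_v(e)`.
[cite: Luscher1983, §3] -/
theorem timeCoupling_orthoTube_eq (u u' : GaugeConfig 3 1 SU2) (v v' : Edge 3 L → Fin 3 → ℝ) :
    timeCoupling su2Rep (orthoTube L u v) (orthoTube L u' v') =
      (L : ℝ) ^ 3 * timeCoupling su2Rep u u' + timeCoupling su2Rep (fun e => chartSU2 (v e)) (fun e => chartSU2 (v' e)) -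
          2 * Fintype.card (Edge 3 L) +
        2 * ∑ e : Edge 3 L, (1 - scalarPart (u (0, e.2) * (u' (0, e.2))⁻¹)) * (1 - scalarPart ((chartSU2 (v' e))⁻¹ * chartSU2 (v e))) -
        2 * ∑ e : Edge 3 L, vecPart ((chartSU2 (v' e))⁻¹ * chartSU2 (v e)) ⬝ᵥ vecPart (u (0, e.2) * (u' (0, e.2))⁻¹) := by
  rw [orthoTube_eq_mul_constLift, orthoTube_eq_mul_constLift]
  exact timeCoupling_chart_eq _ _ u u'

/-- The relative stiff step in chart coordinates, vector part: `(W_{v'}⁻¹ W_v)⃗ = α' v − α v' − v' × v`. [cite: BrockerTomDieck1985, I (1.10)] -/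
theorem vecPart_relStep_chart {x y : Fin 3 → ℝ} (hx : ∑ a, x a ^ 2 ≤ 1) (hy : ∑ a, y a ^ 2 ≤ 1) :
    vecPart ((chartSU2 y)⁻¹ * chartSU2 x) = √(1 - ∑ a, y a ^ 2) • x - √(1 - ∑ a, x a ^ 2) • y - y ⨯₃ x := by
  rw [vecPart_inv_mul, scalarPart_chartSU2 hy, scalarPart_chartSU2 hx, vecPart_chartSU2 hy, vecPart_chartSU2 hx]

/-- ★ **The cross term in chart coordinates**, for any per-direction slow data `a⃗_k` (in `timeCoupling_orthoTube_eq`: `a⃗_k = (u_k u'_k⁻¹)⃗`):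
`Σ_e b⃗_e·a⃗_{k(e)} = Σ_e [α'_e (v_e·a⃗) − α_e (v'_e·a⃗) − (v'_e × v_e)·a⃗]` — linear parts plus the CORIOLIS term. [cite: Luscher1983, §3] -/
theorem kineticCross_eq (a : Fin 3 → Fin 3 → ℝ) {v v' : Edge 3 L → Fin 3 → ℝ} (hv : ∀ e, ∑ c, v e c ^ 2 ≤ 1) (hv' : ∀ e, ∑ c, v' e c ^ 2 ≤ 1) :
    ∑ e : Edge 3 L, vecPart ((chartSU2 (v' e))⁻¹ * chartSU2 (v e)) ⬝ᵥ a e.2 =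
      ∑ e : Edge 3 L, (√(1 - ∑ c, v' e c ^ 2) * (v e ⬝ᵥ a e.2) - √(1 - ∑ c, v e c ^ 2) * (v' e ⬝ᵥ a e.2) - (v' e ⨯₃ v e) ⬝ᵥ a e.2) := by
  refine Finset.sum_congr rfl fun e _ => ?_
  rw [vecPart_relStep_chart (hv e) (hv' e), sub_dotProduct, sub_dotProduct, smul_dotProduct, smul_dotProduct, smul_eq_mul, smul_eq_mul]

/-- ★ **Balance kills the linear parts**: for balanced `v` (`Σ_x v_{(x,k)} = 0`) and slow data depending on the direction only, `Σ_e v_e·a⃗_{k(e)} = 0`.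
[cite: Luscher1983, §3] -/
theorem sum_dot_slow_eq_zero_of_balanced {v : Edge 3 L → Fin 3 → ℝ} (hv : v ∈ balancedSet L) (a : Fin 3 → Fin 3 → ℝ) :
    ∑ e : Edge 3 L, v e ⬝ᵥ a e.2 = 0 := by
  rw [Fintype.sum_prod_type, Finset.sum_comm]
  refine Finset.sum_eq_zero fun k _ => ?_
  simp only [dotProduct]
  rw [Finset.sum_comm]
  refine Finset.sum_eq_zero fun c _ => ?_
  rw [← Finset.sum_mul, (mem_balancedSet L v).1 hv k c, zero_mul]

/-- ★ **The balanced form of the cross term**: `Σ_e b⃗_e·a⃗ = Σ_e [(α'_e − 1)(v_e·a⃗) − (α_e − 1)(v'_e·a⃗) − (v'_e × v_e)·a⃗]` — the linear parts survive only through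
`α − 1 = O(|v|²)` (third order); the leading term is the Coriolis term, first order in the slow step, second order in the stiff amplitude. [cite: Luscher1983, §3] -/
theorem kineticCross_eq_of_balanced (a : Fin 3 → Fin 3 → ℝ) {v v' : Edge 3 L → Fin 3 → ℝ} (hv : v ∈ capBalancedSet L) (hv' : v' ∈ capBalancedSet L) :
    ∑ e : Edge 3 L, vecPart ((chartSU2 (v' e))⁻¹ * chartSU2 (v e)) ⬝ᵥ a e.2 =
      ∑ e : Edge 3 L, ((√(1 - ∑ c, v' e c ^ 2) - 1) * (v e ⬝ᵥ a e.2) - (√(1 - ∑ c, v e c ^ 2) - 1) * (v' e ⬝ᵥ a e.2) - (v' e ⨯₃ v e) ⬝ᵥ a e.2) := by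
  rw [kineticCross_eq a (fun e => sum_sq_le_one_of_cap L hv.2 e) (fun e => sum_sq_le_one_of_cap L hv'.2 e)]
  have e1 : ∀ e : Edge 3 L, √(1 - ∑ c, v' e c ^ 2) * (v e ⬝ᵥ a e.2) - √(1 - ∑ c, v e c ^ 2) * (v' e ⬝ᵥ a e.2) - (v' e ⨯₃ v e) ⬝ᵥ a e.2 =
      ((√(1 - ∑ c, v' e c ^ 2) - 1) * (v e ⬝ᵥ a e.2) - (√(1 - ∑ c, v e c ^ 2) - 1) * (v' e ⬝ᵥ a e.2) - (v' e ⨯₃ v e) ⬝ᵥ a e.2) +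
        (v e ⬝ᵥ a e.2 - v' e ⬝ᵥ a e.2) := fun e => by ring
  have hPQ : ∑ e : Edge 3 L, (v e ⬝ᵥ a e.2 - v' e ⬝ᵥ a e.2) = 0 := by
    rw [Finset.sum_sub_distrib, sum_dot_slow_eq_zero_of_balanced hv.1 a, sum_dot_slow_eq_zero_of_balanced hv'.1 a, sub_zero]
  rw [Finset.sum_congr rfl fun e _ => e1 e, Finset.sum_add_distrib, hPQ, add_zero]

/-- The instance of `kineticCross_eq_of_balanced` inside `timeCoupling_orthoTube_eq` (`a⃗_k = (u_k u'_k⁻¹)⃗`): for capped balanced stiff fields the slow–stiff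
cross term of the ortho chart is the Coriolis sum plus third-order linear remainders. [cite: Luscher1983, §3] -/
theorem kineticCross_orthoTube_eq_of_balanced (u u' : GaugeConfig 3 1 SU2) {v v' : Edge 3 L → Fin 3 → ℝ}
    (hv : v ∈ capBalancedSet L) (hv' : v' ∈ capBalancedSet L) :
    ∑ e : Edge 3 L, vecPart ((chartSU2 (v' e))⁻¹ * chartSU2 (v e)) ⬝ᵥ vecPart (u (0, e.2) * (u' (0, e.2))⁻¹) =
      ∑ e : Edge 3 L, ((√(1 - ∑ c, v' e c ^ 2) - 1) * (v e ⬝ᵥ vecPart (u (0, e.2) * (u' (0, e.2))⁻¹)) -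
        (√(1 - ∑ c, v e c ^ 2) - 1) * (v' e ⬝ᵥ vecPart (u (0, e.2) * (u' (0, e.2))⁻¹)) - (v' e ⨯₃ v e) ⬝ᵥ vecPart (u (0, e.2) * (u' (0, e.2))⁻¹)) :=
  kineticCross_eq_of_balanced (fun k => vecPart (u (0, k) * (u' (0, k))⁻¹)) hv hv'

/-! ## §2 The two-link witness: equal amplitude profiles, different colour planes — the chart exponent is not `F(u,u';|v|,|v'|) + G(v,v')` -/

/-- `Σ_a (t e_c)_a² = t²`. [folklore] -/
theorem sum_single_sq (c : Fin 3) (t : ℝ) : ∑ a, (Pi.single c t : Fin 3 → ℝ) a ^ 2 = t ^ 2 := by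
  rw [Finset.sum_eq_single c (fun a _ ha => by simp [ha]) (fun h => absurd (Finset.mem_univ c) h)]
  simp

/-- `t·e₁ = (0, t, 0)`. [folklore] -/
theorem single_one_eq (t : ℝ) : (Pi.single 1 t : Fin 3 → ℝ) = ![0, t, 0] := by
  funext a; fin_cases a <;> simp

/-- `t·e₂ = (0, 0, t)`. [folklore] -/
theorem single_two_eq (t : ℝ) : (Pi.single 2 t : Fin 3 → ℝ) = ![0, 0, t] := by
  funext a; fin_cases a <;> simp

/-- Per-link value, colour plane 1 against colour plane 2 through the slow step `diagSU2 φ`: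
`(W(t e₁)·diagSU2 φ·W(t e₂)⁻¹)₀ = (1 − t²)cos φ − t² sin φ`. [cite: BrockerTomDieck1985, I (1.10)] -/
theorem scalarPart_link_AB {t : ℝ} (ht : t ^ 2 ≤ 1) (φ : ℝ) :
    scalarPart (chartSU2 (Pi.single 1 t) * diagSU2 φ * (chartSU2 (Pi.single 2 t))⁻¹) = (1 - t ^ 2) * Real.cos φ - t ^ 2 * Real.sin φ := by
  have h1 : ∑ a, (Pi.single 1 t : Fin 3 → ℝ) a ^ 2 ≤ 1 := by rw [sum_single_sq]; exact ht
  have h2 : ∑ a, (Pi.single 2 t : Fin 3 → ℝ) a ^ 2 ≤ 1 := by rw [sum_single_sq]; exact ht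
  have hs : √(1 - t ^ 2) * √(1 - t ^ 2) = 1 - t ^ 2 := Real.mul_self_sqrt (by nlinarith)
  rw [scalarPart_mul, scalarPart_inv, vecPart_inv, scalarPart_mul, vecPart_mul, scalarPart_chartSU2 h1, vecPart_chartSU2 h1,
    scalarPart_chartSU2 h2, vecPart_chartSU2 h2, scalarPart_diagSU2, vecPart_diagSU2, sum_single_sq, sum_single_sq, single_one_eq, single_two_eq]
  simp [dotProduct, Fin.sum_univ_three, cross_apply]
  linear_combination Real.cos φ * hs

/-- Per-link value, colour plane 1 against itself: `(W(t e₁)·diagSU2 φ·W(t e₁)⁻¹)₀ = cos φ` (class function). [cite: BrockerTomDieck1985, I (1.10)] -/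
theorem scalarPart_link_AA (t : ℝ) (φ : ℝ) : scalarPart (chartSU2 (Pi.single 1 t) * diagSU2 φ * (chartSU2 (Pi.single 1 t))⁻¹) = Real.cos φ := by
  rw [scalarPart_conj, scalarPart_diagSU2]

/-- Per-link value with the slow step on the other slice: `(W(t e₁)·(W(t e₂)·diagSU2 φ)⁻¹)₀ = (1 − t²)cos φ + t² sin φ`. [cite: BrockerTomDieck1985, I (1.10)] -/
theorem scalarPart_link_AB' {t : ℝ} (ht : t ^ 2 ≤ 1) (φ : ℝ) :
    scalarPart (chartSU2 (Pi.single 1 t) * (chartSU2 (Pi.single 2 t) * diagSU2 φ)⁻¹) = (1 - t ^ 2) * Real.cos φ + t ^ 2 * Real.sin φ := by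
  have h1 : ∑ a, (Pi.single 1 t : Fin 3 → ℝ) a ^ 2 ≤ 1 := by rw [sum_single_sq]; exact ht
  have h2 : ∑ a, (Pi.single 2 t : Fin 3 → ℝ) a ^ 2 ≤ 1 := by rw [sum_single_sq]; exact ht
  have hs : √(1 - t ^ 2) * √(1 - t ^ 2) = 1 - t ^ 2 := Real.mul_self_sqrt (by nlinarith)
  rw [scalarPart_mul, scalarPart_inv, vecPart_inv, scalarPart_mul, vecPart_mul, scalarPart_chartSU2 h1, vecPart_chartSU2 h1,
    scalarPart_chartSU2 h2, vecPart_chartSU2 h2, scalarPart_diagSU2, vecPart_diagSU2, sum_single_sq, sum_single_sq, single_one_eq, single_two_eq]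
  simp [dotProduct, Fin.sum_univ_three, cross_apply]
  linear_combination Real.cos φ * hs

/-- Per-link value with the slow step on the other slice, same colour plane: `(W(t e₁)·(W(t e₁)·diagSU2 φ)⁻¹)₀ = cos φ`. [cite: BrockerTomDieck1985, I (1.10)] -/
theorem scalarPart_link_AA' (t : ℝ) (φ : ℝ) : scalarPart (chartSU2 (Pi.single 1 t) * (chartSU2 (Pi.single 1 t) * diagSU2 φ)⁻¹) = Real.cos φ := by
  rw [show chartSU2 (Pi.single 1 t) * (chartSU2 (Pi.single 1 t) * diagSU2 φ)⁻¹ = chartSU2 (Pi.single 1 t) * (diagSU2 φ)⁻¹ * (chartSU2 (Pi.single 1 t))⁻¹ by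
    rw [mul_inv_rev, mul_assoc], scalarPart_conj, scalarPart_inv, scalarPart_diagSU2]

/-- ★★ **THE TWO-LINK WITNESS AND ITS CROSS DEFECT, EXACTLY** (every `L ≥ 2`, `ε² ≤ 1/4`).  Slow path `w φ = (diagSU2 φ, 1, 1)` (direction `0` turns); stiff fields
`v^A_e = amp(e)·e₁`, `v^B_e = amp(e)·e₂` with `amp = +ε` at `((0,0,0),0)`, `−ε` at `((1,0,0),0)`, `0` elsewhere: both capped balanced, IDENTICAL amplitude profiles, and
`Δ(φ) := tc(Ψ(w φ,v^A),Ψ(1,v^B)) − tc(Ψ(w φ,v^A),Ψ(1,v^A)) = −4ε²(cos φ + sin φ)`, `Δ'(φ) := tc(Ψ(1,v^A),Ψ(w φ,v^B)) − tc(Ψ(1,v^A),Ψ(w φ,v^A)) = −4ε²(cos φ − sin φ)`,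
`Δ` has derivative `−4ε²` at `φ = 0` — a CORIOLIS (first-order) effect, not a curvature one. [cite: Luscher1983, §3] -/
theorem cross_witness (hL : 2 ≤ L) {ε : ℝ} (hε : ε ^ 2 ≤ 1 / 4) :
    ∃ (w : ℝ → GaugeConfig 3 1 SU2) (vA vB : Edge 3 L → Fin 3 → ℝ),
      vA ∈ capBalancedSet L ∧ vB ∈ capBalancedSet L ∧ (fun e => ∑ a, vB e a ^ 2) = (fun e => ∑ a, vA e a ^ 2) ∧
      (∀ φ : ℝ, timeCoupling su2Rep (orthoTube L (w φ) vA) (orthoTube L 1 vB) - timeCoupling su2Rep (orthoTube L (w φ) vA) (orthoTube L 1 vA) =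
        -4 * ε ^ 2 * (Real.cos φ + Real.sin φ)) ∧
      (∀ φ : ℝ, timeCoupling su2Rep (orthoTube L 1 vA) (orthoTube L (w φ) vB) - timeCoupling su2Rep (orthoTube L 1 vA) (orthoTube L (w φ) vA) =
        -4 * ε ^ 2 * (Real.cos φ - Real.sin φ)) ∧
      HasDerivAt (fun φ : ℝ => timeCoupling su2Rep (orthoTube L (w φ) vA) (orthoTube L 1 vB) - timeCoupling su2Rep (orthoTube L (w φ) vA) (orthoTube L 1 vA))
        (-4 * ε ^ 2) 0 := by
  haveI : Fact (1 < L) := ⟨hL⟩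
  have hne : (((0 : Site 3 L), (0 : Fin 3)) : Edge 3 L) ≠ ((Pi.single 0 1 : Site 3 L), (0 : Fin 3)) := fun h => by
    simpa using congrFun (congrArg Prod.fst h) 0
  set e₀ : Edge 3 L := ((0 : Site 3 L), (0 : Fin 3)) with he₀
  set e₁ : Edge 3 L := ((Pi.single 0 1 : Site 3 L), (0 : Fin 3)) with he₁
  set amp : Edge 3 L → ℝ := fun e => if e = e₀ then ε else if e = e₁ then -ε else 0 with hamp
  have amp0 : amp e₀ = ε := by simp [hamp]
  have amp1 : amp e₁ = -ε := by simp [hamp, hne.symm]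
  have ampo : ∀ e, e ≠ e₀ → e ≠ e₁ → amp e = 0 := fun e h0 h1 => by simp [hamp, h0, h1]
  have ampsq : ∀ e, amp e ^ 2 ≤ ε ^ 2 := fun e => by
    by_cases h0 : e = e₀
    · rw [h0, amp0]
    · by_cases h1 : e = e₁
      · rw [h1, amp1, neg_sq]
      · rw [ampo e h0 h1, zero_pow two_ne_zero]; exact sq_nonneg ε
  have ampbal : ∀ k : Fin 3, ∑ x : Site 3 L, amp (x, k) = 0 := fun k => by
    by_cases hk : k = 0
    · subst hk
      rw [Fintype.sum_eq_add (0 : Site 3 L) (Pi.single 0 1 : Site 3 L) (fun h => hne (congrArg (fun x => (x, (0 : Fin 3))) h)) fun x hx =>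
          ampo _ (fun h => hx.1 (congrArg Prod.fst h)) (fun h => hx.2 (congrArg Prod.fst h)), amp0, amp1, add_neg_cancel]
    · exact Finset.sum_eq_zero fun x _ => ampo _ (fun h => hk (congrArg Prod.snd h)) (fun h => hk (congrArg Prod.snd h))
  have mem : ∀ c : Fin 3, (fun e => (Pi.single c (amp e) : Fin 3 → ℝ)) ∈ capBalancedSet L := fun c => by
    refine ⟨(mem_balancedSet L _).2 fun k a => ?_, fun e => ?_⟩
    · by_cases ha : a = c
      · subst ha; simp only [Pi.single_eq_same]; exact ampbal k
      · simp [Pi.single_eq_of_ne ha]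
    · show ∑ a, (Pi.single c (amp e) : Fin 3 → ℝ) a ^ 2 ≤ 1 / 4
      rw [sum_single_sq]; exact (ampsq e).trans hε
  have hε1 : ε ^ 2 ≤ 1 := hε.trans (by norm_num)
  have hε1' : (-ε) ^ 2 ≤ 1 := by rwa [neg_sq]
  obtain ⟨k0, k1⟩ : e₀.2 = 0 ∧ e₁.2 = 0 := ⟨rfl, rfl⟩
  have hΔ : ∀ φ : ℝ, timeCoupling su2Rep (orthoTube L (fun e => if e.2 = 0 then diagSU2 φ else 1) fun e => Pi.single 1 (amp e))
        (orthoTube L 1 fun e => Pi.single 2 (amp e)) -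
      timeCoupling su2Rep (orthoTube L (fun e => if e.2 = 0 then diagSU2 φ else 1) fun e => Pi.single 1 (amp e))
        (orthoTube L 1 fun e => Pi.single 1 (amp e)) = -4 * ε ^ 2 * (Real.cos φ + Real.sin φ) := fun φ => by
    unfold timeCoupling
    rw [← Finset.sum_sub_distrib, Fintype.sum_eq_add e₀ e₁ hne ?_]
    · simp only [orthoTube_apply, TubeMax.re_trace_su2Rep, Pi.one_apply, mul_one, k0, k1, if_true, amp0, amp1,
        scalarPart_link_AB hε1, scalarPart_link_AB hε1', scalarPart_link_AA]
      ring
    · rintro e ⟨h0, h1⟩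
      simp only [orthoTube_apply, ampo e h0 h1, Pi.single_zero, sub_self]
  have hΔ' : ∀ φ : ℝ, timeCoupling su2Rep (orthoTube L 1 fun e => Pi.single 1 (amp e))
        (orthoTube L (fun e => if e.2 = 0 then diagSU2 φ else 1) fun e => Pi.single 2 (amp e)) -
      timeCoupling su2Rep (orthoTube L 1 fun e => Pi.single 1 (amp e))
        (orthoTube L (fun e => if e.2 = 0 then diagSU2 φ else 1) fun e => Pi.single 1 (amp e)) = -4 * ε ^ 2 * (Real.cos φ - Real.sin φ) := fun φ => by
    unfold timeCoupling
    rw [← Finset.sum_sub_distrib, Fintype.sum_eq_add e₀ e₁ hne ?_]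
    · simp only [orthoTube_apply, TubeMax.re_trace_su2Rep, Pi.one_apply, mul_one, k0, k1, if_true, amp0, amp1,
        scalarPart_link_AB' hε1, scalarPart_link_AB' hε1', scalarPart_link_AA']
      ring
    · rintro e ⟨h0, h1⟩
      simp only [orthoTube_apply, ampo e h0 h1, Pi.single_zero, sub_self]
  refine ⟨fun φ e => if e.2 = 0 then diagSU2 φ else 1, fun e => Pi.single 1 (amp e), fun e => Pi.single 2 (amp e), mem 1, mem 2, ?_, hΔ, hΔ', ?_⟩
  · funext e; simp only [sum_single_sq]
  · have h : HasDerivAt (fun φ => -4 * ε ^ 2 * (Real.cos φ + Real.sin φ)) (-4 * ε ^ 2 * (-Real.sin 0 + Real.cos 0)) 0 :=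
      ((Real.hasDerivAt_cos 0).add (Real.hasDerivAt_sin 0)).const_mul _
    rw [Real.sin_zero, Real.cos_zero, neg_zero, zero_add, mul_one] at h
    exact h.congr_of_eventuallyEq (Filter.Eventually.of_forall fun φ => hΔ φ)

/-- ★★★ **NON-SEPARABILITY, stiff factor frozen at the second slow point**: there are no `F, G` with `tc(Ψ(u,v), Ψ(u',v')) = F(u, u'; (|v_e|²)_e, (|v'_e|²)_e)
+ G(u'; v, v')` for all one-site `u, u'` and all capped balanced `v, v'` (`L ≥ 2`). [cite: Luscher1983, §3] -/
theorem not_separable_frozen_right (hL : 2 ≤ L) :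
    ¬ ∃ (F : GaugeConfig 3 1 SU2 → GaugeConfig 3 1 SU2 → (Edge 3 L → ℝ) → (Edge 3 L → ℝ) → ℝ)
        (G : GaugeConfig 3 1 SU2 → (Edge 3 L → Fin 3 → ℝ) → (Edge 3 L → Fin 3 → ℝ) → ℝ),
        ∀ (u u' : GaugeConfig 3 1 SU2) (v v' : Edge 3 L → Fin 3 → ℝ), v ∈ capBalancedSet L → v' ∈ capBalancedSet L →
          timeCoupling su2Rep (orthoTube L u v) (orthoTube L u' v') =
            F u u' (fun e => ∑ a, v e a ^ 2) (fun e => ∑ a, v' e a ^ 2) + G u' v v' := by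
  rintro ⟨F, G, h⟩
  obtain ⟨w, vA, vB, hA, hB, hprof, hΔ, -, -⟩ := cross_witness hL (by norm_num : ((1 : ℝ) / 2) ^ 2 ≤ 1 / 4)
  have key : ∀ φ : ℝ, -4 * ((1 : ℝ) / 2) ^ 2 * (Real.cos φ + Real.sin φ) = G 1 vA vB - G 1 vA vA := fun φ => by
    rw [← hΔ φ, h _ _ _ _ hA hB, h _ _ _ _ hA hA, hprof]; ring
  have h0 := key 0
  have hπ := key Real.pi
  rw [Real.cos_zero, Real.sin_zero] at h0
  rw [Real.cos_pi, Real.sin_pi] at hπ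
  linarith

/-- ★★★ **NON-SEPARABILITY, stiff factor frozen at the first slow point**: no `F, G` with `tc(Ψ(u,v), Ψ(u',v')) = F(u,u'; |v|², |v'|²) + G(u; v, v')`.
[cite: Luscher1983, §3] -/
theorem not_separable_frozen_left (hL : 2 ≤ L) :
    ¬ ∃ (F : GaugeConfig 3 1 SU2 → GaugeConfig 3 1 SU2 → (Edge 3 L → ℝ) → (Edge 3 L → ℝ) → ℝ)
        (G : GaugeConfig 3 1 SU2 → (Edge 3 L → Fin 3 → ℝ) → (Edge 3 L → Fin 3 → ℝ) → ℝ),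
        ∀ (u u' : GaugeConfig 3 1 SU2) (v v' : Edge 3 L → Fin 3 → ℝ), v ∈ capBalancedSet L → v' ∈ capBalancedSet L →
          timeCoupling su2Rep (orthoTube L u v) (orthoTube L u' v') =
            F u u' (fun e => ∑ a, v e a ^ 2) (fun e => ∑ a, v' e a ^ 2) + G u v v' := by
  rintro ⟨F, G, h⟩
  obtain ⟨w, vA, vB, hA, hB, hprof, -, hΔ', -⟩ := cross_witness hL (by norm_num : ((1 : ℝ) / 2) ^ 2 ≤ 1 / 4)
  have key : ∀ φ : ℝ, -4 * ((1 : ℝ) / 2) ^ 2 * (Real.cos φ - Real.sin φ) = G 1 vA vB - G 1 vA vA := fun φ => by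
    rw [← hΔ' φ, h _ _ _ _ hA hB, h _ _ _ _ hA hA, hprof]; ring
  have h0 := key 0
  have hπ := key Real.pi
  rw [Real.cos_zero, Real.sin_zero] at h0
  rw [Real.cos_pi, Real.sin_pi] at hπ
  linarith

/-- ★★★ **NON-SEPARABILITY (slow-independent stiff factor)** — the product form `K₁^{L³β|m||m'|}(u,u')·G_st(w,w')` of COARSE-DESIGN §23.2 (3) read as an identity of
exponents: no `F, G` with `tc(Ψ(u,v), Ψ(u',v')) = F(u,u'; |v|², |v'|²) + G(v, v')` on `(one-site)² × capBalancedSet²`, `L ≥ 2`. [cite: Luscher1983, §3] -/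
theorem not_separable (hL : 2 ≤ L) :
    ¬ ∃ (F : GaugeConfig 3 1 SU2 → GaugeConfig 3 1 SU2 → (Edge 3 L → ℝ) → (Edge 3 L → ℝ) → ℝ)
        (G : (Edge 3 L → Fin 3 → ℝ) → (Edge 3 L → Fin 3 → ℝ) → ℝ),
        ∀ (u u' : GaugeConfig 3 1 SU2) (v v' : Edge 3 L → Fin 3 → ℝ), v ∈ capBalancedSet L → v' ∈ capBalancedSet L →
          timeCoupling su2Rep (orthoTube L u v) (orthoTube L u' v') =
            F u u' (fun e => ∑ a, v e a ^ 2) (fun e => ∑ a, v' e a ^ 2) + G v v' := by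
  rintro ⟨F, G, h⟩
  exact not_separable_frozen_right hL ⟨F, fun _ v v' => G v v', h⟩

/-! ## §3 Exponent lines: the size of the Coriolis exponent on `T×T` and after kinetic localisation, against `o(λ_b) = o(β^{−1/3})` -/

/-- `β·β^{−a} = β^{−(a−1)}` at the scales `powScale` (`β ≥ 1`). [folklore] -/
theorem beta_mul_powScale {β : ℝ} (hβ : 1 ≤ β) (a : ℝ) : β * powScale a β = powScale (a - 1) β := by
  have hβ0 : 0 < β := by linarith
  rw [powScale_eq hβ, powScale_eq hβ, show -(a - 1) = -a + 1 by ring, Real.rpow_add hβ0, Real.rpow_one]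
  ring

/-- The two Coriolis sizes as scales (`β ≥ 1`): pointwise on `T×T`, `β·β^{−s}·β^{−q'} = β^{−(s+q'−1)}`; after kinetic localisation of the slow step to `β^{−1/2}`,
`β·β^{−1/2}·β^{−q'} = β^{−(q'−1/2)}`. [folklore] -/
theorem coriolis_sizes_eq {β : ℝ} (hβ : 1 ≤ β) (s q' : ℝ) :
    β * powScale s β * powScale q' β = powScale (s + q' - 1) β ∧ β * powScale (1 / 2) β * powScale q' β = powScale (q' - 1 / 2) β := by
  constructor <;> · rw [beta_mul_powScale hβ, ← R23.powScale_add']; congr 1; ring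

/-- ★ **THE POINTWISE LINE `s + q' > 4/3`.**  A relative kernel error `C·β·β^{−s}·β^{−q'}` is `≤ β^{−1/3}` eventually for every constant `C` iff `s + q' > 4/3`.
[cite: Luscher1983, §3] -/
theorem coriolis_core_line_iff {s q' : ℝ} :
    (∀ C : ℝ, ∃ β0 : ℝ, ∀ β : ℝ, β0 ≤ β → C * powScale (s + q' - 1) β ≤ powScale (1 / 3) β) ↔ 4 / 3 < s + q' := by
  rw [R24.forall_mul_powScale_le_eventually_iff]
  constructor <;> intro h <;> linarith

/-- ★ On the whole C4-CORE window (`s < 1/3`) with any stiff layer `q' < 1` the pointwise line FAILS. [cite: Luscher1983, §3] -/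
theorem coriolis_core_line_fails {s q' : ℝ} (hs : s < 1 / 3) (hq : q' < 1) :
    ¬ ∀ C : ℝ, ∃ β0 : ℝ, ∀ β : ℝ, β0 ≤ β → C * powScale (s + q' - 1) β ≤ powScale (1 / 3) β := by
  rw [coriolis_core_line_iff]; intro h; linarith

/-- ★ The pointwise Coriolis size even exceeds lane A's own `η_K = O(β^{−s})` (polylogs are constants here) unless `q' > 1`. [cite: Luscher1983, §3] -/
theorem coriolis_vs_etaK_iff {s q' : ℝ} :
    (∀ C : ℝ, ∃ β0 : ℝ, ∀ β : ℝ, β0 ≤ β → C * powScale (s + q' - 1) β ≤ powScale s β) ↔ 1 < q' := by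
  rw [R24.forall_mul_powScale_le_eventually_iff]
  constructor <;> intro h <;> linarith

/-- ★ **THE KINETIC-TYPICAL LINE `q' > 5/6`.**  After localising the slow step to `|a⃗| ≲ β^{−1/2}` (polylog = constant), the Coriolis exponent `C·β·β^{−1/2}·β^{−q'}` is
`≤ β^{−1/3}` eventually for every `C` iff `q' > 5/6`. [cite: Luscher1983, §3] -/
theorem coriolis_typical_line_iff {q' : ℝ} :
    (∀ C : ℝ, ∃ β0 : ℝ, ∀ β : ℝ, β0 ≤ β → C * powScale (q' - 1 / 2) β ≤ powScale (1 / 3) β) ↔ 5 / 6 < q' := by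
  rw [R24.forall_mul_powScale_le_eventually_iff]
  constructor <;> intro h <;> linarith

/-- The record instances: the stiff layer `q' = 17/20` passes the kinetic-typical line (margin `17/20 − 5/6 = 1/60`); the record pair `(s, q') = (3/16, 17/20)` misses
the pointwise line (Coriolis size `C·β^{−3/80}` there). [folklore] -/
theorem coriolis_record_lines :
    (∀ C : ℝ, ∃ β0 : ℝ, ∀ β : ℝ, β0 ≤ β → C * powScale ((17 : ℝ) / 20 - 1 / 2) β ≤ powScale (1 / 3) β) ∧
      ¬ (∀ C : ℝ, ∃ β0 : ℝ, ∀ β : ℝ, β0 ≤ β → C * powScale ((3 : ℝ) / 16 + 17 / 20 - 1) β ≤ powScale (1 / 3) β) ∧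
      (17 : ℝ) / 20 - 5 / 6 = 1 / 60 ∧ (3 : ℝ) / 16 + 17 / 20 - 1 = 3 / 80 :=
  ⟨coriolis_typical_line_iff.2 (by norm_num), coriolis_core_line_fails (by norm_num) (by norm_num), by norm_num, by norm_num⟩

end Summit.QuantumFields.YangMills.Theorems.TwistedTraceScaling.Negative.R26

end
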